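import Literature.AlgebraicGeometry.Resolution.FrobeniusNormIdeal
import Summits.ResolutionOfSingularities.ResolutionOfSingularities.Theorems.FrobeniusLadderFInjectiveMacaulayficationMonomialPBasisParity
import Mathlib.Algebra.MvPolynomial.Equiv
import Mathlib.Algebra.Polynomial.Monic
import Mathlib.Algebra.Polynomial.Degree.SmallDegree
import Mathlib.RingTheory.Localization.Integer
import Mathlib.Tactic.ComputeDegree
import Mathlib.Tactic.LinearCombination
import HarnessLib

/-!
# The `K²`-basis of `K = Frac(k[x,y,u,t,z]/(z²+x⁴z+y³+u³+t³))` by the 16 square-free monomials in `x,y,u,t` (`k` perfect, char 2)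
# (crux `FInjectiveMacaulayfication` stmt-ResolutionOfSingularities-15315, chain w45a; LEMMA N♭ Tier-2 piece (B); res-L1-w45a-plan-1 R18.1 (3),
# statement shape STATUS l.79137; seat res-L1-w45a-stub-1 g10)

[OURS · L1 W4.5a] Support file (`--supports stmt-ResolutionOfSingularities-15315 --as helper`); replaces the role of NO printed item; NOT a
statement of any manuscript; def-free, unconditional; AI-written (AI review is weaker than expert review).

`A₀ = k[X₀..X₄]/(f)`, `f = X₄² + X₀⁴X₄ + X₁³ + X₂³ + X₃³` (P2d4C, `z = X 4`), `R = k[X₀..X₃]` embedded by `Fin.castSucc`, `z̄ = mk (X 4)`, `m_a = ∏ᵢ x̄ᵢ^{aᵢ}`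
(`a : Fin 4 → Fin 2`). §1 NORMAL FORM `A₀ = R ⊕ R·z̄`: `exists_normalForm` (induction on polynomials via `z̄² = x̄⁴z̄ + ḡ`) and `normalForm_eq_zero`
(uniqueness: under `k[X₀..X₄] ≃ k[X₀..X₃][T]`, `f ↦ T² + C(x⁴)T + C(g)` is monic of degree 2, so divides no nonzero polynomial of degree ≤ 1; any field `k`).
§2 ★ `eq_zero_of_sum_sq_mul_prod_eq_zero`: `Σ_a n_a²·m_a = 0` in `A₀` ⇒ all `n_a = 0` (`n_a = r_a + s_a z̄`, `n_a² m_a = (r_a² + g s_a²) m_a + x⁴ s_a² m_a·z̄`,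
normal form, then the parity lemma of `…MonomialPBasisParity` twice); `exists_eq_sum_sq_mul_generators` (`k` perfect): `A₀ = Σ_j A₀² g_j` over the 32
generators `(m_a)_a ⊔ (m_a z̄)_a` = the `hg` input of `FrobeniusNormMinors.frobeniusNorm_eq_span_det_of_rootRows`.
§3 ★★ for ANY fraction field `K` of `A₀` (`ExpChar K 2`): `linearIndependent_monomials` (clear denominators + §2); `span_monomials_eq_top` (`k` perfect: the
`K²`-span of the `m_a` is multiplicatively closed and contains `k = k²`, `x̄ᵢ`, `z̄ = x̄⁻⁴(z̄² + ȳ²ȳ + ū²ū + t̄²t̄)`, hence `A₀`, hence `K` by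
`span_range_algebraMap_eq_top`); ★★ `exists_monomialBasis : ∃ β : Module.Basis (Fin 4 → Fin 2) (iterateFrobeniusRange K 2 1) K, ∀ a, β a = algebraMap A₀ K m_a`
(+ `…_reindex`); in particular `[K : K²] = 16`. [folklore: `p`-bases; `[K : Kᵖ] = p^{tr.deg}` for function fields over perfect fields]
-/

-- single-problem summit: the doubled namespace component is forced
set_option linter.dupNamespace false

namespace Summit.ResolutionOfSingularities.ResolutionOfSingularities.Theorems.FInjectiveMacaulayfication.MonomialPBasis

open MvPolynomial Literature.AlgebraicGeometry.Resolution Summit.ResolutionOfSingularities.ResolutionOfSingularities.Theorems.FInjectiveMacaulayfication.MonomialPBasisParity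

/-! ## §1 The normal form `A₀ = R ⊕ R·z̄` -/

section NormalForm
variable (k : Type*) [Field k]

/-- The coordinate change `k[X₀..X₄] ≃ₐ k[X₀..X₃][T]`, `X 4 ↦ T`, `X (castSucc j) ↦ C (X j)`. [plumbing] -/
theorem exists_algEquiv_polynomial :
    ∃ e : MvPolynomial (Fin 5) k ≃ₐ[k] Polynomial (MvPolynomial (Fin 4) k),
      e (X 4) = Polynomial.X ∧ ∀ j : Fin 4, e (X (Fin.castSucc j)) = Polynomial.C (X j) := by
  refine ⟨(renameEquiv k (_root_.finRotate 5)).trans (finSuccEquiv k 4), ?_, fun j => ?_⟩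
  · rw [AlgEquiv.trans_apply, renameEquiv_apply, rename_X, show (_root_.finRotate 5) (4 : Fin 5) = 0 by decide, finSuccEquiv_X_zero]
  · have hrot : ∀ j : Fin 4, (_root_.finRotate 5) (Fin.castSucc j) = j.succ := by decide
    rw [AlgEquiv.trans_apply, renameEquiv_apply, rename_X, hrot j, finSuccEquiv_X_succ]

/-- Such a coordinate change sends `rename castSucc r` to the constant `C r`. [plumbing] -/
theorem algEquiv_rename_castSucc (e : MvPolynomial (Fin 5) k ≃ₐ[k] Polynomial (MvPolynomial (Fin 4) k))
    (hej : ∀ j : Fin 4, e (X (Fin.castSucc j)) = Polynomial.C (X j)) (r : MvPolynomial (Fin 4) k) :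
    e (rename Fin.castSucc r) = Polynomial.C r := by
  induction r using MvPolynomial.induction_on with
  | C a =>
    rw [rename_C]
    exact (e.commutes a).trans (by rw [Polynomial.algebraMap_apply]; rfl)
  | add p q hp hq => rw [map_add, map_add, hp, hq, Polynomial.C_add]
  | mul_X p j hp => rw [map_mul, map_mul, hp, rename_X, hej, ← Polynomial.C_mul]

/-- … and `f` to the monic quadratic `T² + C(X₀⁴)·T + C(X₁³+X₂³+X₃³)`. [plumbing] -/
theorem algEquiv_f (e : MvPolynomial (Fin 5) k ≃ₐ[k] Polynomial (MvPolynomial (Fin 4) k)) (he4 : e (X 4) = Polynomial.X)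
    (hej : ∀ j : Fin 4, e (X (Fin.castSucc j)) = Polynomial.C (X j)) (f : MvPolynomial (Fin 5) k)
    (hf : f = X 4 ^ 2 + X 0 ^ 4 * X 4 + X 1 ^ 3 + X 2 ^ 3 + X 3 ^ 3) :
    e f = Polynomial.X ^ 2 + Polynomial.C (X 0 ^ 4) * Polynomial.X + Polynomial.C (X 1 ^ 3 + X 2 ^ 3 + X 3 ^ 3) := by
  rw [hf, map_add, map_add, map_add, map_add, map_pow, map_mul, map_pow, he4, map_pow, map_pow, map_pow,
    show (0 : Fin 5) = Fin.castSucc (0 : Fin 4) from rfl, show (1 : Fin 5) = Fin.castSucc (1 : Fin 4) from rfl,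
    show (2 : Fin 5) = Fin.castSucc (2 : Fin 4) from rfl, show (3 : Fin 5) = Fin.castSucc (3 : Fin 4) from rfl, hej, hej, hej, hej]
  simp only [map_add, map_pow]
  ring

/-- ★ **Uniqueness of the normal form**: `r̄ + s̄·z̄ = 0` in `A₀ = k[X₀..X₄]/(f)` with `r, s ∈ k[X₀..X₃]` forces `r = s = 0` — `f` is monic of degree 2
in `X 4`, so it divides no nonzero polynomial of `X 4`-degree `≤ 1`. Any field `k`. [folklore] -/
theorem normalForm_eq_zero (f : MvPolynomial (Fin 5) k) (hf : f = X 4 ^ 2 + X 0 ^ 4 * X 4 + X 1 ^ 3 + X 2 ^ 3 + X 3 ^ 3)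
    (r s : MvPolynomial (Fin 4) k)
    (h : Ideal.Quotient.mk (Ideal.span {f}) (rename Fin.castSucc r) +
      Ideal.Quotient.mk (Ideal.span {f}) (rename Fin.castSucc s) * Ideal.Quotient.mk (Ideal.span {f}) (X 4) = 0) :
    r = 0 ∧ s = 0 := by
  obtain ⟨e, he4, hej⟩ := exists_algEquiv_polynomial k
  have hmem : rename Fin.castSucc r + rename Fin.castSucc s * X 4 ∈ Ideal.span {f} := by
    rw [← Ideal.Quotient.eq_zero_iff_mem]; simpa only [map_add, map_mul] using h
  obtain ⟨q, hq⟩ := Ideal.mem_span_singleton'.mp hmem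
  have hdvd : e f ∣ Polynomial.C s * Polynomial.X + Polynomial.C r := by
    refine ⟨e q, ?_⟩
    rw [← map_mul, mul_comm f q, hq, map_add, map_mul, algEquiv_rename_castSucc k e hej, algEquiv_rename_castSucc k e hej, he4]
    ring
  rw [algEquiv_f k e he4 hej f hf] at hdvd
  have hmonic : (Polynomial.X ^ 2 + Polynomial.C (X 0 ^ 4 : MvPolynomial (Fin 4) k) * Polynomial.X +
      Polynomial.C (X 1 ^ 3 + X 2 ^ 3 + X 3 ^ 3)).Monic := by monicity!
  have hdeg : (Polynomial.X ^ 2 + Polynomial.C (X 0 ^ 4 : MvPolynomial (Fin 4) k) * Polynomial.X +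
      Polynomial.C (X 1 ^ 3 + X 2 ^ 3 + X 3 ^ 3)).degree = 2 := by compute_degree!
  have hzero : Polynomial.C s * Polynomial.X + Polynomial.C r = 0 := by_contra fun h0 =>
    hmonic.not_dvd_of_degree_lt h0 (by rw [hdeg]; exact Polynomial.degree_linear_lt) hdvd
  have h0 := congrArg (Polynomial.coeff · 0) hzero
  have h1 := congrArg (Polynomial.coeff · 1) hzero
  simp only [Polynomial.coeff_add, Polynomial.coeff_C_mul, Polynomial.coeff_X_zero, Polynomial.coeff_C_zero, mul_zero, zero_add,
    Polynomial.coeff_zero, Polynomial.coeff_X_one, mul_one, Polynomial.coeff_C_succ, add_zero] at h0 h1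
  exact ⟨h0, h1⟩

/-- `x̄₀ ≠ 0` in `A₀` (normal form with `r = X 0`, `s = 0`). [plumbing] -/
theorem mk_X_castSucc_ne_zero (f : MvPolynomial (Fin 5) k) (hf : f = X 4 ^ 2 + X 0 ^ 4 * X 4 + X 1 ^ 3 + X 2 ^ 3 + X 3 ^ 3) (j : Fin 4) :
    Ideal.Quotient.mk (Ideal.span {f}) (X (Fin.castSucc j)) ≠ 0 := by
  intro h0
  have h := normalForm_eq_zero k f hf (X j) 0 (by rw [rename_X, map_zero, map_zero, zero_mul, add_zero]; exact h0)
  exact X_ne_zero j h.1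

/-- The monomial `m_a = ∏ᵢ x̄ᵢ^{aᵢ}` is the image of `∏ᵢ Xᵢ^{aᵢ} ∈ k[X₀..X₃]`. [plumbing] -/
theorem prod_mk_X_pow_eq (f : MvPolynomial (Fin 5) k) (e : Fin 4 → ℕ) :
    (∏ i, Ideal.Quotient.mk (Ideal.span {f}) (X (Fin.castSucc i)) ^ e i) =
      Ideal.Quotient.mk (Ideal.span {f}) (rename Fin.castSucc (∏ i, X i ^ e i)) := by
  simp only [map_prod, map_pow, rename_X]

variable [CharP k 2]

/-- The relation in `A₀` (characteristic 2): `z̄² = x̄₀⁴·z̄ + (x̄₁³ + x̄₂³ + x̄₃³)`. [plumbing] -/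
theorem mk_X_four_sq (f : MvPolynomial (Fin 5) k) (hf : f = X 4 ^ 2 + X 0 ^ 4 * X 4 + X 1 ^ 3 + X 2 ^ 3 + X 3 ^ 3) :
    Ideal.Quotient.mk (Ideal.span {f}) (X 4) ^ 2 =
      Ideal.Quotient.mk (Ideal.span {f}) (X (Fin.castSucc 0)) ^ 4 * Ideal.Quotient.mk (Ideal.span {f}) (X 4) +
        (Ideal.Quotient.mk (Ideal.span {f}) (X (Fin.castSucc 1)) ^ 3 + Ideal.Quotient.mk (Ideal.span {f}) (X (Fin.castSucc 2)) ^ 3 +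
          Ideal.Quotient.mk (Ideal.span {f}) (X (Fin.castSucc 3)) ^ 3) := by
  have h2 : (2 : MvPolynomial (Fin 5) k ⧸ Ideal.span {f}) = 0 := by
    rw [← map_ofNat (Ideal.Quotient.mk (Ideal.span {f})) 2, CharTwo.two_eq_zero, map_zero]
  have hrel : Ideal.Quotient.mk (Ideal.span {f}) (X 4 ^ 2 + X 0 ^ 4 * X 4 + X 1 ^ 3 + X 2 ^ 3 + X 3 ^ 3) = 0 := by
    rw [← hf]
    exact Ideal.Quotient.eq_zero_iff_mem.mpr (Ideal.mem_span_singleton_self f)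
  simp only [map_add, map_mul, map_pow] at hrel
  change Ideal.Quotient.mk (Ideal.span {f}) (X 4) ^ 2 =
      Ideal.Quotient.mk (Ideal.span {f}) (X 0) ^ 4 * Ideal.Quotient.mk (Ideal.span {f}) (X 4) +
        (Ideal.Quotient.mk (Ideal.span {f}) (X 1) ^ 3 + Ideal.Quotient.mk (Ideal.span {f}) (X 2) ^ 3 +
          Ideal.Quotient.mk (Ideal.span {f}) (X 3) ^ 3)
  linear_combination hrel - (Ideal.Quotient.mk (Ideal.span {f}) (X 0) ^ 4 * Ideal.Quotient.mk (Ideal.span {f}) (X 4) +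
    (Ideal.Quotient.mk (Ideal.span {f}) (X 1) ^ 3 + Ideal.Quotient.mk (Ideal.span {f}) (X 2) ^ 3 +
      Ideal.Quotient.mk (Ideal.span {f}) (X 3) ^ 3)) * h2

/-- ★ **Existence of the normal form** (characteristic 2): every element of `A₀` is `r̄ + s̄·z̄` with `r, s ∈ k[X₀..X₃]`. [folklore] -/
theorem exists_normalForm (f : MvPolynomial (Fin 5) k) (hf : f = X 4 ^ 2 + X 0 ^ 4 * X 4 + X 1 ^ 3 + X 2 ^ 3 + X 3 ^ 3)
    (x : MvPolynomial (Fin 5) k ⧸ Ideal.span {f}) :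
    ∃ r s : MvPolynomial (Fin 4) k, x = Ideal.Quotient.mk (Ideal.span {f}) (rename Fin.castSucc r) +
      Ideal.Quotient.mk (Ideal.span {f}) (rename Fin.castSucc s) * Ideal.Quotient.mk (Ideal.span {f}) (X 4) := by
  obtain ⟨q, rfl⟩ := Ideal.Quotient.mk_surjective x
  induction q using MvPolynomial.induction_on with
  | C a => exact ⟨C a, 0, by rw [rename_C, map_zero, map_zero, zero_mul, add_zero]⟩
  | add p q hp hq =>
    obtain ⟨⟨r₁, s₁, h₁⟩, ⟨r₂, s₂, h₂⟩⟩ := And.intro hp hq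
    exact ⟨r₁ + r₂, s₁ + s₂, by rw [map_add, h₁, h₂]; simp only [map_add]; ring⟩
  | mul_X p i hp =>
    obtain ⟨⟨r, s, h⟩, ⟨j, rfl⟩ | rfl⟩ := And.intro hp (Fin.eq_castSucc_or_eq_last i)
    · exact ⟨r * X j, s * X j, by rw [map_mul, h]; simp only [map_mul, rename_X]; ring⟩
    · refine ⟨s * (X 1 ^ 3 + X 2 ^ 3 + X 3 ^ 3), r + s * X 0 ^ 4, ?_⟩
      have hz := mk_X_four_sq k f hf
      rw [map_mul, h, show X (Fin.last 4) = (X 4 : MvPolynomial (Fin 5) k) from rfl]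
      simp only [map_mul, map_add, map_pow, rename_X]
      linear_combination Ideal.Quotient.mk (Ideal.span {f}) (rename Fin.castSucc s) * hz

/-- Squaring a normal form against a third polynomial `m` (characteristic 2):
`(r̄ + s̄z̄)²·m̄ = ((r² + s²g)m)‾ + ((x⁴s²m)‾)·z̄`, `g = X₁³+X₂³+X₃³`, `x = X₀`. [plumbing] -/
theorem normalForm_sq_mul (f : MvPolynomial (Fin 5) k) (hf : f = X 4 ^ 2 + X 0 ^ 4 * X 4 + X 1 ^ 3 + X 2 ^ 3 + X 3 ^ 3)
    (r s m : MvPolynomial (Fin 4) k) :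
    (Ideal.Quotient.mk (Ideal.span {f}) (rename Fin.castSucc r) +
        Ideal.Quotient.mk (Ideal.span {f}) (rename Fin.castSucc s) * Ideal.Quotient.mk (Ideal.span {f}) (X 4)) ^ 2 *
      Ideal.Quotient.mk (Ideal.span {f}) (rename Fin.castSucc m) =
    Ideal.Quotient.mk (Ideal.span {f}) (rename Fin.castSucc ((r ^ 2 + s ^ 2 * (X 1 ^ 3 + X 2 ^ 3 + X 3 ^ 3)) * m)) +
      Ideal.Quotient.mk (Ideal.span {f}) (rename Fin.castSucc (X 0 ^ 4 * s ^ 2 * m)) * Ideal.Quotient.mk (Ideal.span {f}) (X 4) := by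
  have h2 : (2 : MvPolynomial (Fin 5) k ⧸ Ideal.span {f}) = 0 := by
    rw [← map_ofNat (Ideal.Quotient.mk (Ideal.span {f})) 2, CharTwo.two_eq_zero, map_zero]
  have hz := mk_X_four_sq k f hf
  simp only [map_mul, map_add, map_pow, rename_X]
  linear_combination (Ideal.Quotient.mk (Ideal.span {f}) (rename Fin.castSucc s)) ^ 2 * Ideal.Quotient.mk (Ideal.span {f}) (rename Fin.castSucc m) * hz +
    Ideal.Quotient.mk (Ideal.span {f}) (rename Fin.castSucc r) * Ideal.Quotient.mk (Ideal.span {f}) (rename Fin.castSucc s) *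
      Ideal.Quotient.mk (Ideal.span {f}) (X 4) * Ideal.Quotient.mk (Ideal.span {f}) (rename Fin.castSucc m) * h2

/-! ## §2 Independence of the 16 monomials over squares in `A₀` -/

/-- ★ **`Σ_a n_a² · m_a = 0` in `A₀` forces every `n_a = 0`** (`a` over the 16 square-free exponents, `m_a = ∏ᵢ x̄ᵢ^{aᵢ}`): normal form +
parity lemma. Characteristic 2, any field `k`. [folklore: `p`-bases] -/
theorem eq_zero_of_sum_sq_mul_prod_eq_zero (f : MvPolynomial (Fin 5) k)
    (hf : f = X 4 ^ 2 + X 0 ^ 4 * X 4 + X 1 ^ 3 + X 2 ^ 3 + X 3 ^ 3)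
    (n : (Fin 4 → Fin 2) → MvPolynomial (Fin 5) k ⧸ Ideal.span {f})
    (h : ∑ a, n a ^ 2 * ∏ i, Ideal.Quotient.mk (Ideal.span {f}) (X (Fin.castSucc i)) ^ (a i : ℕ) = 0) (a : Fin 4 → Fin 2) :
    n a = 0 := by
  choose r s hrs using fun a => exists_normalForm k f hf (n a)
  -- the relation in normal form
  have key : ∀ b, n b ^ 2 * ∏ i, Ideal.Quotient.mk (Ideal.span {f}) (X (Fin.castSucc i)) ^ (b i : ℕ) =
      Ideal.Quotient.mk (Ideal.span {f}) (rename Fin.castSucc ((r b ^ 2 + s b ^ 2 * (X 1 ^ 3 + X 2 ^ 3 + X 3 ^ 3)) * ∏ i, X i ^ (b i : ℕ))) +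
        Ideal.Quotient.mk (Ideal.span {f}) (rename Fin.castSucc (X 0 ^ 4 * s b ^ 2 * ∏ i, X i ^ (b i : ℕ))) *
          Ideal.Quotient.mk (Ideal.span {f}) (X 4) := fun b => by
    rw [prod_mk_X_pow_eq, hrs b, normalForm_sq_mul k f hf]
  simp_rw [key] at h
  rw [Finset.sum_add_distrib, ← Finset.sum_mul, ← map_sum, ← map_sum, ← map_sum, ← map_sum] at h
  obtain ⟨hA, hB⟩ := normalForm_eq_zero k f hf _ _ h
  -- the `z̄`-component: `x⁴ · Σ s_b² m_b = 0`
  have hB' : ∑ b, s b ^ 2 * ∏ i, X i ^ (b i : ℕ) = (0 : MvPolynomial (Fin 4) k) := by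
    refine (mul_eq_zero.mp ?_).resolve_left (pow_ne_zero 4 (X_ne_zero (0 : Fin 4) : (X 0 : MvPolynomial (Fin 4) k) ≠ 0))
    rw [Finset.mul_sum, ← hB]
    exact Finset.sum_congr rfl fun b _ => by ring
  have hs : ∀ b, s b = 0 := eq_zero_of_sum_pow_mul_prod_eq_zero 2 s hB'
  -- the `R`-component
  have hA' : ∑ b, r b ^ 2 * ∏ i, X i ^ (b i : ℕ) = (0 : MvPolynomial (Fin 4) k) := by
    rw [← hA]
    exact Finset.sum_congr rfl fun b _ => by rw [hs b]; ring
  have hr : ∀ b, r b = 0 := eq_zero_of_sum_pow_mul_prod_eq_zero 2 r hA'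
  rw [hrs a, hr a, hs a, map_zero, map_zero, zero_mul, add_zero]

/-- ★ **(B3) `A₀ = Σ_a A₀²·m_a + Σ_a A₀²·(m_a z̄)`** (`k` PERFECT of characteristic 2): every `w ∈ A₀` is `Σ_a c_a² m_a + Σ_a d_a² (m_a z̄)` — the
square-spanning of `F_*A₀` by the 32 generators `m_a, m_a z̄` (res-L1-w45a-lead-1 INTERFACE 07:39:00Z, shape verbatim). [folklore] -/
theorem exists_eq_sum_sq_add_sum_sq [PerfectRing k 2] (f : MvPolynomial (Fin 5) k)
    (hf : f = X 4 ^ 2 + X 0 ^ 4 * X 4 + X 1 ^ 3 + X 2 ^ 3 + X 3 ^ 3) (w : MvPolynomial (Fin 5) k ⧸ Ideal.span {f}) :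
    ∃ c d : (Fin 4 → Fin 2) → MvPolynomial (Fin 5) k ⧸ Ideal.span {f},
      w = ∑ a, c a ^ 2 * ∏ i, Ideal.Quotient.mk (Ideal.span {f}) (X (Fin.castSucc i)) ^ (a i : ℕ) +
        ∑ a, d a ^ 2 * ((∏ i, Ideal.Quotient.mk (Ideal.span {f}) (X (Fin.castSucc i)) ^ (a i : ℕ)) * Ideal.Quotient.mk (Ideal.span {f}) (X 4)) := by
  obtain ⟨r, s, hw⟩ := exists_normalForm k f hf w
  obtain ⟨⟨ρ, hρ⟩, ⟨σ, hσ⟩⟩ := And.intro (exists_eq_sum_pow_mul_prod 2 r) (exists_eq_sum_pow_mul_prod 2 s)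
  refine ⟨fun a => Ideal.Quotient.mk (Ideal.span {f}) (rename Fin.castSucc (ρ a)),
    fun a => Ideal.Quotient.mk (Ideal.span {f}) (rename Fin.castSucc (σ a)), ?_⟩
  rw [hw, hρ, hσ]
  simp only [map_sum, map_mul, map_pow, map_prod, rename_X, Finset.sum_mul]
  exact congrArg₂ (· + ·) rfl (Finset.sum_congr rfl fun b _ => by ring)

/-- The same as ONE family over `(Fin 4 → Fin 2) ⊕ (Fin 4 → Fin 2)` with exponent `2 ^ 1`: the `hg` input of
`FrobeniusNormMinors.frobeniusNorm_eq_span_det_of_rootRows` for `g = Sum.elim (m_a)_a (m_a z̄)_a` (unit-row half first, as `UnitRowMinors` stacks). [plumbing] -/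
theorem exists_eq_sum_sq_mul_generators [PerfectRing k 2] (f : MvPolynomial (Fin 5) k)
    (hf : f = X 4 ^ 2 + X 0 ^ 4 * X 4 + X 1 ^ 3 + X 2 ^ 3 + X 3 ^ 3) (w : MvPolynomial (Fin 5) k ⧸ Ideal.span {f}) :
    ∃ c : (Fin 4 → Fin 2) ⊕ (Fin 4 → Fin 2) → MvPolynomial (Fin 5) k ⧸ Ideal.span {f},
      w = ∑ j, c j ^ 2 ^ 1 * Sum.elim (fun a : Fin 4 → Fin 2 => ∏ i, Ideal.Quotient.mk (Ideal.span {f}) (X (Fin.castSucc i)) ^ (a i : ℕ))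
        (fun a : Fin 4 → Fin 2 => (∏ i, Ideal.Quotient.mk (Ideal.span {f}) (X (Fin.castSucc i)) ^ (a i : ℕ)) *
          Ideal.Quotient.mk (Ideal.span {f}) (X 4)) j := by
  obtain ⟨c, d, hw⟩ := exists_eq_sum_sq_add_sum_sq k f hf w
  exact ⟨Sum.elim c d, by rw [Fintype.sum_sum_type]; simpa only [Sum.elim_inl, Sum.elim_inr, pow_one] using hw⟩

end NormalForm

/-! ## §3 The `K²`-basis of the fraction field -/

section FractionField
variable (k : Type*) [Field k] [CharP k 2] (f : MvPolynomial (Fin 5) k)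
  (hf : f = X 4 ^ 2 + X 0 ^ 4 * X 4 + X 1 ^ 3 + X 2 ^ 3 + X 3 ^ 3)
  (K : Type*) [Field K] [Algebra (MvPolynomial (Fin 5) k ⧸ Ideal.span {f}) K]
  [IsFractionRing (MvPolynomial (Fin 5) k ⧸ Ideal.span {f}) K] [ExpChar K 2]

include hf in
/-- ★★ **The 16 monomials `∏ᵢ x̄ᵢ^{aᵢ}` (`aᵢ ∈ {0,1}`) are linearly independent over `K² ⊆ K = Frac A₀`** (any field `k` of characteristic 2):
clear denominators and apply `eq_zero_of_sum_sq_mul_prod_eq_zero`. [folklore] -/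
theorem linearIndependent_monomials :
    LinearIndependent (iterateFrobeniusRange K 2 1) (fun a : Fin 4 → Fin 2 =>
      algebraMap (MvPolynomial (Fin 5) k ⧸ Ideal.span {f}) K (∏ i, Ideal.Quotient.mk (Ideal.span {f}) (X (Fin.castSucc i)) ^ (a i : ℕ))) := by
  haveI : IsDomain (MvPolynomial (Fin 5) k ⧸ Ideal.span {f}) :=
    Function.Injective.isDomain (algebraMap (MvPolynomial (Fin 5) k ⧸ Ideal.span {f}) K)
      (IsFractionRing.injective (MvPolynomial (Fin 5) k ⧸ Ideal.span {f}) K)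
  rw [Fintype.linearIndependent_iff]
  intro c hc a₀
  have hd : ∀ a, ∃ d : K, d ^ 2 = (c a : K) := fun a => by
    obtain ⟨y, hy⟩ := mem_iterateFrobeniusRange_iff.mp (c a).2
    exact ⟨y, by simpa using hy⟩
  choose d hd using hd
  obtain ⟨D, hD⟩ := IsLocalization.exist_integer_multiples_of_finite (nonZeroDivisors (MvPolynomial (Fin 5) k ⧸ Ideal.span {f})) d
  choose n hn using fun a => RingHom.mem_rangeS.mp (hD a)
  have hsum : ∑ a, n a ^ 2 * ∏ i, Ideal.Quotient.mk (Ideal.span {f}) (X (Fin.castSucc i)) ^ (a i : ℕ) = 0 := by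
    apply IsFractionRing.injective (MvPolynomial (Fin 5) k ⧸ Ideal.span {f}) K
    rw [map_sum, map_zero]
    have hterm : ∀ a, algebraMap (MvPolynomial (Fin 5) k ⧸ Ideal.span {f}) K
        (n a ^ 2 * ∏ i, Ideal.Quotient.mk (Ideal.span {f}) (X (Fin.castSucc i)) ^ (a i : ℕ)) =
        algebraMap (MvPolynomial (Fin 5) k ⧸ Ideal.span {f}) K D ^ 2 *
          ((c a : K) * algebraMap (MvPolynomial (Fin 5) k ⧸ Ideal.span {f}) K
            (∏ i, Ideal.Quotient.mk (Ideal.span {f}) (X (Fin.castSucc i)) ^ (a i : ℕ))) := fun a => by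
      rw [map_mul, map_pow, hn a, Algebra.smul_def, mul_pow, hd a]
      ring
    have hc' : ∑ a, (c a : K) * algebraMap (MvPolynomial (Fin 5) k ⧸ Ideal.span {f}) K
        (∏ i, Ideal.Quotient.mk (Ideal.span {f}) (X (Fin.castSucc i)) ^ (a i : ℕ)) = 0 := by
      rw [← hc]
      exact Finset.sum_congr rfl fun a _ => rfl
    simp_rw [hterm, ← Finset.mul_sum, hc', mul_zero]
  have hn0 := eq_zero_of_sum_sq_mul_prod_eq_zero k f hf n hsum a₀
  have hDne : algebraMap (MvPolynomial (Fin 5) k ⧸ Ideal.span {f}) K D ≠ 0 :=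
    IsFractionRing.to_map_ne_zero_of_mem_nonZeroDivisors D.2
  have hda : d a₀ = 0 := by
    have := hn a₀; rw [hn0, map_zero, Algebra.smul_def] at this
    exact (mul_eq_zero.mp this.symm).resolve_left hDne
  exact Subtype.ext (by rw [← hd a₀, hda]; simp)

include hf in
/-- ★★ **The 16 monomials span `K` over `K²`** (`k` PERFECT of characteristic 2): their `K²`-span is closed under products (`x̄ᵢ² ∈ K²`), contains
`k = k²`, the `x̄ᵢ`, and `z̄ = x̄₀⁻⁴(z̄² + x̄₁²x̄₁ + x̄₂²x̄₂ + x̄₃²x̄₃)`, hence the image of `A₀`, hence `K` (`span_range_algebraMap_eq_top`). [folklore] -/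
theorem span_monomials_eq_top [PerfectRing k 2] :
    Submodule.span (iterateFrobeniusRange K 2 1) (Set.range fun a : Fin 4 → Fin 2 =>
      algebraMap (MvPolynomial (Fin 5) k ⧸ Ideal.span {f}) K (∏ i, Ideal.Quotient.mk (Ideal.span {f}) (X (Fin.castSucc i)) ^ (a i : ℕ))) = ⊤ := by
  set S := Submodule.span (iterateFrobeniusRange K 2 1) (Set.range fun a : Fin 4 → Fin 2 =>
      algebraMap (MvPolynomial (Fin 5) k ⧸ Ideal.span {f}) K (∏ i, Ideal.Quotient.mk (Ideal.span {f}) (X (Fin.castSucc i)) ^ (a i : ℕ)))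
    with hS
  haveI : IsDomain (MvPolynomial (Fin 5) k ⧸ Ideal.span {f}) :=
    Function.Injective.isDomain (algebraMap (MvPolynomial (Fin 5) k ⧸ Ideal.span {f}) K)
      (IsFractionRing.injective (MvPolynomial (Fin 5) k ⧸ Ideal.span {f}) K)
  have hsq : ∀ y : K, y ^ 2 ∈ iterateFrobeniusRange K 2 1 := fun y => by
    simpa using pow_mem_iterateFrobeniusRange (p := 2) (e := 1) y
  have hsmul : ∀ (y w : K), w ∈ S → y ^ 2 * w ∈ S := fun y w hw =>
    S.smul_mem (⟨y ^ 2, hsq y⟩ : iterateFrobeniusRange K 2 1) hw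
  -- (1) every monomial lies in `S`
  have hmono : ∀ e : Fin 4 → ℕ, algebraMap (MvPolynomial (Fin 5) k ⧸ Ideal.span {f}) K
      (∏ i, Ideal.Quotient.mk (Ideal.span {f}) (X (Fin.castSucc i)) ^ e i) ∈ S := by
    intro e
    have he : (∏ i, Ideal.Quotient.mk (Ideal.span {f}) (X (Fin.castSucc i)) ^ e i) =
        (∏ i, Ideal.Quotient.mk (Ideal.span {f}) (X (Fin.castSucc i)) ^ (e i / 2)) ^ 2 *
          ∏ i, Ideal.Quotient.mk (Ideal.span {f}) (X (Fin.castSucc i)) ^ ((fun i => (⟨e i % 2, Nat.mod_lt _ two_pos⟩ : Fin 2)) i : ℕ) := by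
      rw [← Finset.prod_pow, ← Finset.prod_mul_distrib]
      refine Finset.prod_congr rfl fun i _ => ?_
      rw [← pow_mul, ← pow_add]
      congr 1
      dsimp only
      omega
    rw [he, map_mul, map_pow]
    exact hsmul _ _ (Submodule.subset_span ⟨_, rfl⟩)
  have h1 : (1 : K) ∈ S := by simpa using hmono 0
  -- (2) `S` is closed under products
  have hmul : ∀ x ∈ S, ∀ y ∈ S, x * y ∈ S := by
    have hle : S * S ≤ S := by
      rw [hS, Submodule.span_mul_span, Submodule.span_le]
      rintro _ ⟨_, ⟨a, rfl⟩, _, ⟨b, rfl⟩, rfl⟩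
      change _ * _ ∈ S
      rw [← map_mul, ← Finset.prod_mul_distrib]
      simp_rw [← pow_add]
      exact hmono _
    intro x hx y hy
    exact hle (Submodule.mul_mem_mul hx hy)
  -- (3) constants (k perfect)
  have hC : ∀ κ : k, algebraMap (MvPolynomial (Fin 5) k ⧸ Ideal.span {f}) K (Ideal.Quotient.mk (Ideal.span {f}) (C κ)) ∈ S := by
    intro κ
    obtain ⟨ρ, hρ⟩ := surjective_frobenius k 2 κ
    rw [← hρ, frobenius_def, C_pow, map_pow, map_pow, ← mul_one (_ ^ 2)]
    exact hsmul _ _ h1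
  -- (4) the variables
  have hX : ∀ j : Fin 4, algebraMap (MvPolynomial (Fin 5) k ⧸ Ideal.span {f}) K (Ideal.Quotient.mk (Ideal.span {f}) (X (Fin.castSucc j))) ∈ S := by
    intro j
    have := hmono (Pi.single j 1)
    rwa [Finset.prod_eq_single j (fun i _ hi => by rw [Pi.single_eq_of_ne hi, pow_zero]) (fun hj => absurd (Finset.mem_univ j) hj),
      Pi.single_eq_same, pow_one] at this
  have hz : algebraMap (MvPolynomial (Fin 5) k ⧸ Ideal.span {f}) K (Ideal.Quotient.mk (Ideal.span {f}) (X 4)) ∈ S := by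
    have hx0 : algebraMap (MvPolynomial (Fin 5) k ⧸ Ideal.span {f}) K (Ideal.Quotient.mk (Ideal.span {f}) (X (Fin.castSucc 0))) ≠ 0 :=
      fun h0 => mk_X_castSucc_ne_zero k f hf 0 ((IsFractionRing.injective (MvPolynomial (Fin 5) k ⧸ Ideal.span {f}) K)
        (by rw [h0, map_zero]))
    have hrel := congrArg (algebraMap (MvPolynomial (Fin 5) k ⧸ Ideal.span {f}) K) (mk_X_four_sq k f hf)
    simp only [map_add, map_mul, map_pow] at hrel
    set Z := algebraMap (MvPolynomial (Fin 5) k ⧸ Ideal.span {f}) K (Ideal.Quotient.mk (Ideal.span {f}) (X 4))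
    set A := algebraMap (MvPolynomial (Fin 5) k ⧸ Ideal.span {f}) K (Ideal.Quotient.mk (Ideal.span {f}) (X (Fin.castSucc 0)))
    set Y := algebraMap (MvPolynomial (Fin 5) k ⧸ Ideal.span {f}) K (Ideal.Quotient.mk (Ideal.span {f}) (X (Fin.castSucc 1)))
    set U := algebraMap (MvPolynomial (Fin 5) k ⧸ Ideal.span {f}) K (Ideal.Quotient.mk (Ideal.span {f}) (X (Fin.castSucc 2)))
    set T := algebraMap (MvPolynomial (Fin 5) k ⧸ Ideal.span {f}) K (Ideal.Quotient.mk (Ideal.span {f}) (X (Fin.castSucc 3)))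
    have hA4 : A ^ 4 ≠ 0 := pow_ne_zero _ hx0
    have hZ : Z = ((A ^ 2)⁻¹) ^ 2 * (Z ^ 2 + (Y ^ 2 * Y + U ^ 2 * U + T ^ 2 * T)) := by
      have hinv : ((A ^ 2)⁻¹) ^ 2 * A ^ 4 = 1 := by
        rw [inv_pow, ← pow_mul, show 2 * 2 = 4 by norm_num, inv_mul_cancel₀ hA4]
      have h2 : (2 : K) = 0 := by
        rw [← map_ofNat (algebraMap (MvPolynomial (Fin 5) k ⧸ Ideal.span {f}) K) 2,
          ← map_ofNat (Ideal.Quotient.mk (Ideal.span {f})) 2, CharTwo.two_eq_zero, map_zero, map_zero]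
      linear_combination (-(((A ^ 2)⁻¹) ^ 2)) * hrel + (-Z) * hinv + (-(((A ^ 2)⁻¹) ^ 2 * (Y ^ 3 + U ^ 3 + T ^ 3))) * h2
    rw [hZ]
    exact hsmul _ _ (S.add_mem (by rw [← mul_one (Z ^ 2)]; exact hsmul _ _ h1)
      (S.add_mem (S.add_mem (hsmul _ _ (hX 1)) (hsmul _ _ (hX 2))) (hsmul _ _ (hX 3))))
  -- (5) the image of `A₀`
  have hA : ∀ q : MvPolynomial (Fin 5) k, algebraMap (MvPolynomial (Fin 5) k ⧸ Ideal.span {f}) K (Ideal.Quotient.mk (Ideal.span {f}) q) ∈ S := by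
    intro q
    induction q using MvPolynomial.induction_on with
    | C κ => exact hC κ
    | add p q hp hq => rw [map_add, map_add]; exact S.add_mem hp hq
    | mul_X p i hp =>
      rw [map_mul, map_mul]
      refine hmul _ hp _ ?_
      rcases Fin.eq_castSucc_or_eq_last i with ⟨j, rfl⟩ | rfl
      · exact hX j
      · exact hz
  -- (6) conclude
  rw [eq_top_iff, ← span_range_algebraMap_eq_top (p := 2) (e := 1) (A := MvPolynomial (Fin 5) k ⧸ Ideal.span {f}) (K := K), Submodule.span_le]
  rintro _ ⟨x, rfl⟩
  obtain ⟨q, rfl⟩ := Ideal.Quotient.mk_surjective x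
  exact hA q

include hf in
/-- ★★★ **The `K²`-basis by the 16 square-free monomials** (Tier-2 piece (B) of LEMMA N♭): for `k` perfect of characteristic 2 and ANY fraction field `K` of
`A₀ = k[X₀..X₄]/(X₄² + X₀⁴X₄ + X₁³ + X₂³ + X₃³)`, there is a basis `β` of `K` over `K² = iterateFrobeniusRange K 2 1` indexed by `a : Fin 4 → Fin 2` with
`β a = ∏ᵢ x̄ᵢ^{aᵢ}`. In particular `[K : K²] = 2⁴`. [folklore: `[K : Kᵖ] = p^{tr.deg K/k}` over a perfect field] -/
theorem exists_monomialBasis [PerfectRing k 2] :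
    ∃ β : Module.Basis (Fin 4 → Fin 2) (iterateFrobeniusRange K 2 1) K,
      ∀ a, β a = algebraMap (MvPolynomial (Fin 5) k ⧸ Ideal.span {f}) K
        (∏ i, Ideal.Quotient.mk (Ideal.span {f}) (X (Fin.castSucc i)) ^ (a i : ℕ)) :=
  ⟨Module.Basis.mk (linearIndependent_monomials k f hf K) (span_monomials_eq_top k f hf K).ge, fun a => Module.Basis.mk_apply _ _ a⟩

include hf in
/-- The same basis re-indexed along any `σ : (Fin 4 → Fin 2) ≃ ι` (e.g. an `x`-parity splitting `ι₀ ⊕ ι₁`). [plumbing] -/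
theorem exists_monomialBasis_reindex [PerfectRing k 2] {ι : Type*} (σ : (Fin 4 → Fin 2) ≃ ι) :
    ∃ β : Module.Basis ι (iterateFrobeniusRange K 2 1) K,
      ∀ i, β i = algebraMap (MvPolynomial (Fin 5) k ⧸ Ideal.span {f}) K
        (∏ j, Ideal.Quotient.mk (Ideal.span {f}) (X (Fin.castSucc j)) ^ ((σ.symm i) j : ℕ)) := by
  obtain ⟨β, hβ⟩ := exists_monomialBasis k f hf K
  exact ⟨β.reindex σ, fun i => by rw [Module.Basis.reindex_apply, hβ]⟩

end FractionField

end Summit.ResolutionOfSingularities.ResolutionOfSingularities.Theorems.FInjectiveMacaulayfication.MonomialPBasis
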